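import Literature.MathematicalPhysics.QuantumLattice.CentreSymmetry
import Literature.MathematicalPhysics.QuantumLattice.BalabanRGHaarIterates
import Literature.MathematicalPhysics.QuantumFieldTheory.LatticeGaugeDobrushin
import Literature.Probability.LatticeModels.DobrushinComparisonBoundarySet
import Literature.Probability.LatticeModels.DobrushinTiltSharp
import HarnessLib

/-!
# Unbroken centre symmetry in Dobrushin's uniqueness regime
# (Chatterjee, CMP 385 (2021), Def. 2.1 at strong coupling; Georgii 2011, Thm. 8.20)

S. Chatterjee, *A probabilistic mechanism for quark confinement*, CMP **385** (2021) 1007–1039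
[Chatterjee2021], defines «unbroken center symmetry» (Def. 2.1, tree `CentreUnbroken d ρ β`,
`CentreSymmetry.lean`): for some slab height `n ≥ 1` and every boundary condition `δ`, every Gibbs measure
of the Wilson theory restricted to the slab `{0 ≤ x₀ ≤ n}` (tree `slabGibbsMeasures ρ β n δ`) is invariant
under the centre transforms; Theorem 2.2 (PROVED in the tree,
`chatterjee2021_confinement_of_centreUnbroken_holds`) turns it into confinement (`V(R) → ∞`). Theorem 2.4
derives it from exponential decay of correlations under arbitrary boundary conditions, and p. 7 l. 9 of the
paper records that this decay «can be shown to hold for essentially any lattice gauge theory when `β` is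
small enough, using the methods of [Dobrushin–Shlosman 1985]».

This file proves the DOBRUSHIN-REGIME form of the criterion, for EVERY compact metrisable gauge group,
every continuous representation, every dimension and every slab height: if the one-link conditional laws
of the Wilson specification `ymSpecification ρ β` satisfy Dobrushin's condition in the Vasserstein form
(`DobrushinMetric.IsKRContraction`, row sums `≤ c < 1`), then for every `n` and `δ` the slab theory has AT
MOST ONE Gibbs measure (`subsingleton_slabGibbsMeasures_of_isKRContraction`); since the centre transforms
act on `slabGibbsMeasures ρ β n δ` (`map_centreTransform_mem_slabGibbsMeasures`), centre symmetry is unbroken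
at every height (`slabCentreUnbroken_of_isKRContraction`, `centreUnbroken_of_isKRContraction`). Fed with the
total-variation one-link estimate (Simon's lemma, `isKRContraction_ymSpecification_tv`, valid for every `G`, `ρ`,
`β`) this gives the hypothesis-free strong-coupling corner `12 (d−1)² C_ρ |β| < 1`
(`centreUnbroken_of_abs_plaquetteObs_le`, `exists_centreUnbroken_abs_lt`; unitary `ρ`: `C_ρ = N`,
`centreUnbroken_of_unitary`).

## The mechanism (§1, abstract; Georgii 2011 Thm. 8.20)

`DobrushinFrozen.*`: for a specification `γ` on `V → S` with `IsKRContraction γ r nbr C`, `0 ≤ r ≤ R`, row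
sums `≤ c < 1`, a «frozen region» is a set `W ⊆ V` of free sites with an exhaustion profile `ℓ : V → ℕ`
(`ℓ z ≤ ℓ x + 1` for `z ∈ nbr x`, and for every level `m` a finite `Λ ⊆ W` containing all sites of `W` of
level `< m`). Two probability measures that are frozen to the same `ζ` off `W` and satisfy the DLR equations
for the kernels `γ_Λ`, `Λ ⊆ W` finite, agree on every bounded local `r`-Lipschitz observable
(`integral_eq_of_dlrOn`), hence are equal when `r` dominates a metric generating the σ-algebra of `S`
(`measure_eq_of_dlrOn`). Proof: by the DLR equations `μ(f) − ν(f) = ∫∫ [γ_Λ(f|ω) − γ_Λ(f|η)] dμ dν`; the two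
boundary conditions differ only at free sites of level `≥ m`, so Dobrushin's comparison of finite-volume
kernels (tree `abs_kernel_sub_le_of_superSolution_of_ne`, Georgii Thm. 8.20) with the super-solution
`d_z = c^{m − ℓ z}` gives `|γ_Λ(f|ω) − γ_Λ(f|η)| ≤ R Σ_{z ∈ Δ_f} c^{m − ℓ z} δ_z(f) → 0` (`m → ∞`).

## The slab (§2–§4)

For the Wilson specification the free sites are the interior slab edges (`IsSlabInteriorEdge n`), the
profile is `⌊‖x‖_∞⌋` of the base point (plaquette neighbours move it by `≤ 1`,
`norm_sub_le_one_of_mem_linkPlaqNbr`), and a slab Gibbs measure with boundary condition `δ` is DLR for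
`ymSpecification ρ β Λ`, `Λ ⊆` interior, and frozen to `δ` elsewhere (`mem_slabGibbsMeasures_iff`). §4 re-proves
in Literature the every-group total-variation Dobrushin coefficient `2(d−1) C_ρ |β|` of the Summits file
`Summits/Ventures/YMGap/Thresholds/StrongCouplingAllGroups.lean` (cell `pub-ymgap`, there
`isKRContraction_ymSpecification_osc`; Literature may not import Summits).

Not here: Chatterjee's Theorem 2.4 itself (decay under arbitrary boundary conditions at ANY `β` ⇒ unbroken
centre symmetry; printed proof §§4–11 is a coupling iteration, not a Dobrushin condition) — it stays the
named fact `chatterjee2021_areaLaw_of_strongExpDecay`.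

## References
* S. Chatterjee, CMP 385 (2021) 1007–1039, arXiv:2006.16229: §2.3, Def. 2.1, Thm. 2.2, §2.4 (p. 7 l. 9).
* H.-O. Georgii, *Gibbs Measures and Phase Transitions*, 2nd ed. (2011): Thm. 8.7, Thm. 8.20, §5.1.
* H. Föllmer, LNM 1362 (1988), Ch. I, (2.9)–(2.10), Remark (2.17).
* B. Simon, CMP 68 (1979) 183–185 (the one-site total-variation lemma).
* R. L. Dobrushin, Theory Probab. Appl. 13 (1968) 197–224; 15 (1970) 458–486.
-/

noncomputable section

open MeasureTheory ProbabilityTheory Filter Function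
open scoped Topology

namespace Literature.MathematicalPhysics.QuantumLattice

open Literature.Probability.LatticeModels
open Literature.Probability.LatticeModels.DobrushinMetric

/-! ### §1 Dobrushin uniqueness with a frozen region (abstract specification) -/

namespace DobrushinFrozen

variable {V S : Type*} [MeasurableSpace S] {γ : Specification V S} {r : S → S → ℝ}
  {nbr : V → Finset V} {C : V → V → ℝ}

/-- **One DLR equation, for observables** (Georgii 2011, Remark 1.24; Friedli–Velenik 2017, eq. (6.20)):
if the probability measure `μ` satisfies the DLR equation `∫ γ_Λ(A|η) dμ(η) = μ(A)` for ONE finite volume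
`Λ` of a specification `γ`, then `∫ (∫ f dγ_Λ(·|η)) dμ(η) = ∫ f dμ` for every `μ`-integrable `f` (Mathlib
`Kernel.integral_comp`; the tree's `IsGibbsMeasure.integral_integral_eq` assumes all DLR equations).
[cite: Georgii2011, Rem. 1.24] -/
theorem integral_integral_eq_of_dlr (hγ : IsSpecification γ) {μ : Measure (V → S)}
    [IsProbabilityMeasure μ] (Λ : Finset V)
    (hDLR : ∀ A : Set (V → S), MeasurableSet A → ∫⁻ η, γ Λ η A ∂μ = μ A)
    {f : (V → S) → ℝ} (hf : Integrable f μ) :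
    ∫ η, ∫ σ, f σ ∂(γ Λ η) ∂μ = ∫ σ, f σ ∂μ := by
  let κ : Kernel (V → S) (V → S) := ⟨γ Λ, hγ.measurable_fun Λ⟩
  have hbind : μ.bind (γ Λ) = μ := by
    ext A hA
    rw [Measure.bind_apply hA (hγ.measurable_fun Λ).aemeasurable]
    exact hDLR A hA
  have hcomp : (κ ∘ₖ Kernel.const Unit μ) () = μ := by
    rw [Kernel.comp_apply, Kernel.const_apply]
    exact hbind
  have hfi : Integrable f ((κ ∘ₖ Kernel.const Unit μ) ()) := by rwa [hcomp]
  have key := Kernel.integral_comp hfi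
  rw [hcomp, Kernel.const_apply] at key
  exact key.symm

/-- **Kernel comparison with an exhaustion profile** (Georgii 2011, Thm. 8.20, with the super-solution
`d_z = c^{m − ℓ z}`): let `γ` satisfy Dobrushin's condition in the Vasserstein form with row sums `≤ c < 1`,
let `ℓ : V → ℕ` satisfy `ℓ z ≤ ℓ x + 1` for `z ∈ nbr x`, and let the boundary conditions `ω, η` differ,
outside `Λ`, only at sites of level `ℓ ≥ m`. Then for bounded measurable `f` depending on `Δ` with
`r`-Lipschitz vector `δ`: `|∫ f dγ_Λ(·|ω) − ∫ f dγ_Λ(·|η)| ≤ R Σ_{z ∈ Δ} c^{m − ℓ z} δ_z`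
(`d` is a super-solution: `Σ_{z ∈ nbr x} C x z c^{m − ℓ z} ≤ c · c^{m − ℓ x − 1} ≤ c^{m − ℓ x}`, and `d = 1`
where `ω ≠ η`). [cite: Georgii2011, Thm. 8.20] -/
theorem abs_kernel_sub_le_of_profile [DecidableEq V] (hγ : IsSpecification γ)
    (hC : IsKRContraction γ r nbr C) {R : ℝ} (hr0 : ∀ a b, 0 ≤ r a b) (hrR : ∀ a b, r a b ≤ R)
    (hR : 0 ≤ R) {c : ℝ} (hc0 : 0 ≤ c) (hc1 : c < 1) (hrow : ∀ x, ∑ y ∈ nbr x, C x y ≤ c)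
    {ℓ : V → ℕ} (hℓ : ∀ x, ∀ z ∈ nbr x, ℓ z ≤ ℓ x + 1) (Λ : Finset V) (m : ℕ) (ω η : V → S)
    (hωη : ∀ z, z ∉ Λ → ω z ≠ η z → m ≤ ℓ z)
    {f : (V → S) → ℝ} (hfm : Measurable f) {Δ : Finset V} (hfdep : DependsOn f (↑Δ : Set V))
    {B : ℝ} (hB : ∀ σ, |f σ| ≤ B) {δ : V → ℝ} (hδ : IsLipBound r f δ) :
    |(∫ σ, f σ ∂(γ Λ ω)) - ∫ σ, f σ ∂(γ Λ η)| ≤ R * ∑ z ∈ Δ, c ^ (m - ℓ z) * δ z := by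
  refine abs_kernel_sub_le_of_superSolution_of_ne hγ hC hr0 hrR hR Λ ω η (d := fun z => c ^ (m - ℓ z))
    (fun z => pow_nonneg hc0 _) (fun z hz hne => ?_) (fun x _ => ?_) hc0 hc1 (fun x _ => ?_)
    hfm hfdep hB hδ
  · -- `d = 1` where the boundary conditions differ outside `Λ`
    have h0 : m - ℓ z = 0 := Nat.sub_eq_zero_of_le (hωη z hz hne)
    simp only [h0, pow_zero, le_refl]
  · -- super-solution
    have hterm : ∀ z ∈ nbr x, C x z * c ^ (m - ℓ z) ≤ C x z * c ^ (m - ℓ x - 1) := fun z hz =>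
      mul_le_mul_of_nonneg_left
        (pow_le_pow_of_le_one hc0 hc1.le (by have := hℓ x z hz; omega)) (hC.nonneg x z)
    calc ∑ z ∈ nbr x, C x z * c ^ (m - ℓ z)
        ≤ ∑ z ∈ nbr x, C x z * c ^ (m - ℓ x - 1) := Finset.sum_le_sum hterm
      _ = (∑ z ∈ nbr x, C x z) * c ^ (m - ℓ x - 1) := by rw [Finset.sum_mul]
      _ ≤ c * c ^ (m - ℓ x - 1) := mul_le_mul_of_nonneg_right (hrow x) (pow_nonneg hc0 _)
      _ = c ^ (m - ℓ x - 1 + 1) := by rw [pow_succ, mul_comm]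
      _ ≤ c ^ (m - ℓ x) := pow_le_pow_of_le_one hc0 hc1.le (by omega)
  · -- restricted row sums
    calc ∑ z ∈ nbr x, (if z ∈ Λ then C x z else 0)
        ≤ ∑ z ∈ nbr x, C x z := Finset.sum_le_sum fun z _ => by
          split_ifs
          · exact le_rfl
          · exact hC.nonneg x z
      _ ≤ c := hrow x

/-- **Dobrushin uniqueness with a frozen region, on observables** (Georgii 2011, Thm. 8.20 applied in a
subvolume with frozen exterior; Chatterjee 2021 p. 7: the small-`β` slab theory «using the methods of
[Dobrushin–Shlosman]»). Let `γ` satisfy Dobrushin's condition in the Vasserstein form (`0 ≤ r ≤ R`, row sums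
`≤ c < 1`), let `W` be the set of free sites with an exhaustion profile `ℓ` (`ℓ z ≤ ℓ x + 1` along `nbr`;
for every level `m` a finite `Λ ⊆ W` outside which all free sites have level `≥ m`). If two probability
measures are both frozen to `ζ` off `W` (a.e.) and both satisfy the DLR equations for every finite
`Λ ⊆ W`, they agree on every bounded measurable local observable with an `r`-Lipschitz vector.
[cite: Georgii2011, Thm. 8.20] -/
theorem integral_eq_of_dlrOn [DecidableEq V] (hγ : IsSpecification γ)
    (hC : IsKRContraction γ r nbr C) {R : ℝ} (hr0 : ∀ a b, 0 ≤ r a b) (hrR : ∀ a b, r a b ≤ R)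
    (hR : 0 ≤ R) {c : ℝ} (hc0 : 0 ≤ c) (hc1 : c < 1) (hrow : ∀ x, ∑ y ∈ nbr x, C x y ≤ c)
    {ℓ : V → ℕ} (hℓ : ∀ x, ∀ z ∈ nbr x, ℓ z ≤ ℓ x + 1) {W : Set V}
    (hW : ∀ m : ℕ, ∃ Λ : Finset V, (↑Λ : Set V) ⊆ W ∧ ∀ z ∈ W, z ∉ Λ → m ≤ ℓ z)
    (ζ : V → S) {μ ν : Measure (V → S)} [IsProbabilityMeasure μ] [IsProbabilityMeasure ν]
    (hμζ : ∀ᵐ σ ∂μ, ∀ z ∉ W, σ z = ζ z) (hνζ : ∀ᵐ σ ∂ν, ∀ z ∉ W, σ z = ζ z)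
    (hμ : ∀ Λ : Finset V, (↑Λ : Set V) ⊆ W →
      ∀ A : Set (V → S), MeasurableSet A → ∫⁻ η, γ Λ η A ∂μ = μ A)
    (hν : ∀ Λ : Finset V, (↑Λ : Set V) ⊆ W →
      ∀ A : Set (V → S), MeasurableSet A → ∫⁻ η, γ Λ η A ∂ν = ν A)
    {f : (V → S) → ℝ} (hfm : Measurable f) {Δ : Finset V} (hfdep : DependsOn f (↑Δ : Set V))
    {B : ℝ} (hB : ∀ σ, |f σ| ≤ B) {δ : V → ℝ} (hδ : IsLipBound r f δ) :
    ∫ σ, f σ ∂μ = ∫ σ, f σ ∂ν := by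
  -- the bound at level `m`
  set b : ℕ → ℝ := fun m => R * ∑ z ∈ Δ, c ^ (m - ℓ z) * δ z with hb
  have hb_tendsto : Tendsto b atTop (𝓝 0) := by
    have h1 : ∀ z ∈ Δ, Tendsto (fun m : ℕ => c ^ (m - ℓ z) * δ z) atTop (𝓝 0) := fun z _ => by
      have h := ((tendsto_pow_atTop_nhds_zero_of_lt_one hc0 hc1).comp
        (tendsto_sub_atTop_nat (ℓ z))).mul_const (δ z)
      simpa using h
    have h2 := (tendsto_finsetSum Δ h1).const_mul R
    simpa [hb] using h2
  -- `|μ f − ν f| ≤ b m` for every level `m`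
  have hle : ∀ m, |(∫ σ, f σ ∂μ) - ∫ σ, f σ ∂ν| ≤ b m := by
    intro m
    obtain ⟨Λ, hΛW, hΛ⟩ := hW m
    set F : (V → S) → ℝ := fun η => ∫ σ, f σ ∂(γ Λ η) with hF
    have hFm : Measurable F := by
      let κ : Kernel (V → S) (V → S) := ⟨γ Λ, hγ.measurable_fun Λ⟩
      exact (hfm.stronglyMeasurable.integral_kernel (κ := κ)).measurable
    have hFb : ∀ η, |F η| ≤ B := fun η => by
      haveI := hγ.isProbability Λ η
      have h := norm_integral_le_of_norm_le_const (μ := γ Λ η) (f := f) (C := B)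
        (ae_of_all _ fun σ => by rw [Real.norm_eq_abs]; exact hB σ)
      simpa [hF] using h
    have hμF : ∫ σ, f σ ∂μ = ∫ η, F η ∂μ :=
      (integral_integral_eq_of_dlr hγ Λ (hμ Λ hΛW) (integrable_of_abs_le' hfm hB)).symm
    have hνF : ∫ σ, f σ ∂ν = ∫ η, F η ∂ν :=
      (integral_integral_eq_of_dlr hγ Λ (hν Λ hΛW) (integrable_of_abs_le' hfm hB)).symm
    -- pointwise comparison for pairs of configurations frozen to `ζ` off `W`
    have hpair : ∀ ω η : V → S, (∀ z ∉ W, ω z = ζ z) → (∀ z ∉ W, η z = ζ z) →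
        |F ω - F η| ≤ b m := by
      intro ω η hω hη
      refine abs_kernel_sub_le_of_profile hγ hC hr0 hrR hR hc0 hc1 hrow hℓ Λ m ω η
        (fun z hz hne => ?_) hfm hfdep hB hδ
      by_cases hzW : z ∈ W
      · exact hΛ z hzW hz
      · exact absurd ((hω z hzW).trans (hη z hzW).symm) hne
    have hFiν : Integrable F ν := integrable_of_abs_le' hFm hFb
    have hFiμ : Integrable F μ := integrable_of_abs_le' hFm hFb
    -- integrate over `η` under `ν`
    have h1 : ∀ ω : V → S, (∀ z ∉ W, ω z = ζ z) → |F ω - ∫ η, F η ∂ν| ≤ b m := by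
      intro ω hω
      have hcst : F ω - ∫ η, F η ∂ν = ∫ η, (F ω - F η) ∂ν := by
        rw [integral_sub (integrable_const _) hFiν, integral_const]
        simp
      rw [hcst]
      have h := norm_integral_le_of_norm_le_const (μ := ν) (f := fun η => F ω - F η) (C := b m)
        (by
          filter_upwards [hνζ] with η hη
          rw [Real.norm_eq_abs]
          exact hpair ω η hω hη)
      simpa using h
    -- integrate over `ω` under `μ`
    have h2 : |(∫ ω, F ω ∂μ) - ∫ η, F η ∂ν| ≤ b m := by
      have hcst : (∫ ω, F ω ∂μ) - ∫ η, F η ∂ν = ∫ ω, (F ω - ∫ η, F η ∂ν) ∂μ := by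
        rw [integral_sub hFiμ (integrable_const _), integral_const]
        simp
      rw [hcst]
      have h := norm_integral_le_of_norm_le_const (μ := μ) (f := fun ω => F ω - ∫ η, F η ∂ν)
        (C := b m)
        (by
          filter_upwards [hμζ] with ω hω
          rw [Real.norm_eq_abs]
          exact h1 ω hω)
      simpa using h
    rw [hμF, hνF]
    exact h2
  -- let `m → ∞`
  have h0 : |(∫ σ, f σ ∂μ) - ∫ σ, f σ ∂ν| ≤ 0 := ge_of_tendsto' hb_tendsto hle
  have h00 : (∫ σ, f σ ∂μ) - ∫ σ, f σ ∂ν = 0 := abs_nonpos_iff.1 h0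
  linarith

/-- **Dobrushin uniqueness with a frozen region** (Georgii 2011, Thm. 8.20 in a subvolume with frozen
exterior; uniqueness Thm. 8.7 is the case `W = V`): under the hypotheses of `integral_eq_of_dlrOn`, if
moreover the weight `r` dominates (up to `A`) the pseudo-metric `dist ∘ val` of a map `val` generating the
σ-algebra of `S` (so that local `r`-Lipschitz observables determine probability measures,
`measure_eq_of_forall_integral_eq_of_isLipBound`), the two measures are EQUAL: the DLR system on the free
region `W` with boundary condition `ζ` has at most one solution. [cite: Georgii2011, Thm. 8.20] -/
theorem measure_eq_of_dlrOn [DecidableEq V] (hγ : IsSpecification γ)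
    (hC : IsKRContraction γ r nbr C) {R : ℝ} (hr0 : ∀ a b, 0 ≤ r a b) (hrR : ∀ a b, r a b ≤ R)
    (hR : 0 ≤ R) {c : ℝ} (hc0 : 0 ≤ c) (hc1 : c < 1) (hrow : ∀ x, ∑ y ∈ nbr x, C x y ≤ c)
    {ℓ : V → ℕ} (hℓ : ∀ x, ∀ z ∈ nbr x, ℓ z ≤ ℓ x + 1) {W : Set V}
    (hW : ∀ m : ℕ, ∃ Λ : Finset V, (↑Λ : Set V) ⊆ W ∧ ∀ z ∈ W, z ∉ Λ → m ≤ ℓ z)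
    {X : Type*} [PseudoMetricSpace X] [MeasurableSpace X] [BorelSpace X] (val : S → X)
    (hS : ‹MeasurableSpace S› = MeasurableSpace.comap val ‹MeasurableSpace X›)
    {A : ℝ} (hA0 : 0 ≤ A) (hA : ∀ a b, dist (val a) (val b) ≤ A * r a b)
    (ζ : V → S) {μ ν : Measure (V → S)} [IsProbabilityMeasure μ] [IsProbabilityMeasure ν]
    (hμζ : ∀ᵐ σ ∂μ, ∀ z ∉ W, σ z = ζ z) (hνζ : ∀ᵐ σ ∂ν, ∀ z ∉ W, σ z = ζ z)
    (hμ : ∀ Λ : Finset V, (↑Λ : Set V) ⊆ W →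
      ∀ A : Set (V → S), MeasurableSet A → ∫⁻ η, γ Λ η A ∂μ = μ A)
    (hν : ∀ Λ : Finset V, (↑Λ : Set V) ⊆ W →
      ∀ A : Set (V → S), MeasurableSet A → ∫⁻ η, γ Λ η A ∂ν = ν A) :
    μ = ν := by
  refine measure_eq_of_forall_integral_eq_of_isLipBound val hS fun f Δ δ hfm hdep hf1 hδ => ?_
  -- an `A δ`-Lipschitz bound for the weight `r`
  have hδ' : IsLipBound r f fun y => A * δ y :=
    ⟨fun y => mul_nonneg hA0 (hδ.nonneg y), fun y σ τ hστ =>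
      (hδ.le y σ τ hστ).trans (by
        calc δ y * dist (val (σ y)) (val (τ y)) ≤ δ y * (A * r (σ y) (τ y)) :=
              mul_le_mul_of_nonneg_left (hA _ _) (hδ.nonneg y)
          _ = A * δ y * r (σ y) (τ y) := by ring)⟩
  exact integral_eq_of_dlrOn hγ hC hr0 hrR hR hc0 hc1 hrow hℓ hW ζ hμζ hνζ hμ hν hfm hdep hf1 hδ'

end DobrushinFrozen

/-! ### §2 The slab theory in Dobrushin's regime has at most one Gibbs measure -/

section Slab

open Literature.MathematicalPhysics.QuantumFieldTheory (linkPlaqNbr mem_linkPlaqNbr_iff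
  norm_sub_le_one_of_mem_linkPlaqNbr card_linkPlaqNbr_le isSpecification_ymSpecification_of_t2Space
  siteLaw_ymSpecification_eq_tilted_haar isKRContraction_ymSpecification haarProbability)

variable {d N : ℕ} {G : Type*} [Group G] (ρ : G →* Matrix (Fin N) (Fin N) ℂ)

/-- The exhaustion profile of the slab: the integer part of the `ℓ^∞` norm of the base point of a link
moves by at most `1` along plaquette neighbours (`norm_sub_le_one_of_mem_linkPlaqNbr`). [folklore] -/
private theorem floor_norm_le_of_mem_linkPlaqNbr {x z : ZdEdge d} (hz : z ∈ linkPlaqNbr x) :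
    ⌊‖z.1‖⌋₊ ≤ ⌊‖x.1‖⌋₊ + 1 := by
  have h1 : ‖x.1 - z.1‖ ≤ 1 := norm_sub_le_one_of_mem_linkPlaqNbr hz
  have h2 : ‖z.1‖ ≤ ‖x.1‖ + 1 := by
    calc ‖z.1‖ = ‖x.1 - (x.1 - z.1)‖ := by rw [sub_sub_cancel]
      _ ≤ ‖x.1‖ + ‖x.1 - z.1‖ := norm_sub_le _ _
      _ ≤ ‖x.1‖ + 1 := by linarith
  calc ⌊‖z.1‖⌋₊ ≤ ⌊‖x.1‖ + 1⌋₊ := Nat.floor_mono h2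
    _ = ⌊‖x.1‖⌋₊ + 1 := Nat.floor_add_one (norm_nonneg _)

/-- The interior slab edges of level `< m` (base point in the `ℓ^∞` ball of radius `m`) form a finite set:
the free region of the slab is exhausted by finite volumes. [folklore] -/
private theorem exists_finset_slabInterior_level [NeZero d] (n m : ℕ) :
    ∃ Λ : Finset (ZdEdge d), (↑Λ : Set (ZdEdge d)) ⊆ {e | IsSlabInteriorEdge n e} ∧
      ∀ z ∈ {e : ZdEdge d | IsSlabInteriorEdge n e}, z ∉ Λ → m ≤ ⌊‖z.1‖⌋₊ := by
  classical
  refine ⟨((Fintype.piFinset fun _ : Fin d => Finset.Icc (-(m : ℤ)) m) ×ˢ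
      (Finset.univ : Finset (Fin d))).filter (fun e => IsSlabInteriorEdge n e),
    fun e he => (Finset.mem_filter.1 (Finset.mem_coe.1 he)).2, fun z hz hzΛ => ?_⟩
  have hbox : z.1 ∉ Fintype.piFinset fun _ : Fin d => Finset.Icc (-(m : ℤ)) m := by
    intro h
    exact hzΛ (Finset.mem_filter.2 ⟨Finset.mem_product.2 ⟨h, Finset.mem_univ _⟩, hz⟩)
  rw [Fintype.mem_piFinset] at hbox
  push Not at hbox
  obtain ⟨i, hi⟩ := hbox
  rw [Finset.mem_Icc, not_and_or, not_le, not_le] at hi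
  have habs : (m : ℝ) ≤ |((z.1 i : ℤ) : ℝ)| := by
    rcases hi with hi | hi
    · have h' : ((z.1 i : ℤ) : ℝ) < -(m : ℝ) := by exact_mod_cast hi
      rw [le_abs]
      right
      linarith
    · have h' : (m : ℝ) < ((z.1 i : ℤ) : ℝ) := by exact_mod_cast hi
      rw [le_abs]
      left
      linarith
  refine Nat.le_floor ?_
  calc (m : ℝ) ≤ |((z.1 i : ℤ) : ℝ)| := habs
    _ = ‖z.1 i‖ := (Int.norm_eq_abs _).symm
    _ ≤ ‖z.1‖ := norm_le_pi_norm _ i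

variable [TopologicalSpace G] [IsTopologicalGroup G] [CompactSpace G] [MeasurableSpace G]
  [BorelSpace G] [T2Space G] [SecondCountableTopology G] [NeZero d]

omit [T2Space G] [SecondCountableTopology G] in
/-- A slab Gibbs measure with boundary condition `δ` satisfies the DLR equations of the FULL Wilson
specification for every finite set of interior edges (the slab kernel of an interior volume is the Wilson
kernel, `slabSpecification ρ β n Λ = ymSpecification ρ β Λ` for `Λ ⊆` interior). [cite: Chatterjee2021, §2.3] -/
theorem dlr_ymSpecification_of_mem_slabGibbsMeasures {β : ℝ} {n : ℕ} {δ : LGConfig d G}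
    {μ : Measure (LGConfig d G)} (hμ : μ ∈ slabGibbsMeasures ρ β n δ) (Λ : Finset (ZdEdge d))
    (hΛ : (↑Λ : Set (ZdEdge d)) ⊆ {e | IsSlabInteriorEdge n e}) (A : Set (LGConfig d G))
    (hA : MeasurableSet A) : ∫⁻ η, ymSpecification ρ β Λ η A ∂μ = μ A := by
  have h := hμ.1.2 Λ A hA
  have hfilter : Λ.filter (IsSlabInteriorEdge (d := d) n) = Λ :=
    Finset.filter_true_of_mem fun e he => hΛ (Finset.mem_coe.2 he)
  simpa only [slabSpecification, hfilter] using h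

/-- ★ **The slab theory in Dobrushin's regime has at most one Gibbs measure, for every height and every
boundary condition.** If the one-link conditional laws of the Wilson specification `ymSpecification ρ β`
satisfy Dobrushin's condition in the Vasserstein form (`IsKRContraction` over the plaquette neighbours,
bounded weight `0 ≤ r ≤ R` dominating a metric `dist ∘ val` that generates the σ-algebra of `G`, row sums
`≤ c < 1`), then `slabGibbsMeasures ρ β n δ` is a subsingleton for every `n` and `δ` (`DobrushinFrozen.measure_eq_of_dlrOn`
with the interior slab edges as free region and the profile `⌊‖x‖_∞⌋`). This is Georgii's «no phase transition in
any subvolume under Dobrushin's condition» (Thm. 8.20) for Chatterjee's slab theory (2021, §2.3).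
[cite: Georgii2011, Thm. 8.20] -/
theorem subsingleton_slabGibbsMeasures_of_isKRContraction (hρ : Continuous ρ) {β : ℝ}
    {r : G → G → ℝ} {C : ZdEdge d → ZdEdge d → ℝ}
    (hKR : IsKRContraction (ymSpecification (d := d) ρ β) r linkPlaqNbr C)
    {R : ℝ} (hr0 : ∀ a b, 0 ≤ r a b) (hrR : ∀ a b, r a b ≤ R)
    {X : Type*} [PseudoMetricSpace X] [MeasurableSpace X] [BorelSpace X] (val : G → X)
    (hS : ‹MeasurableSpace G› = MeasurableSpace.comap val ‹MeasurableSpace X›)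
    {A : ℝ} (hA0 : 0 ≤ A) (hA : ∀ a b, dist (val a) (val b) ≤ A * r a b)
    {c : ℝ} (hc0 : 0 ≤ c) (hc1 : c < 1) (hrow : ∀ x, ∑ y ∈ linkPlaqNbr x, C x y ≤ c)
    (n : ℕ) (δ : LGConfig d G) :
    (slabGibbsMeasures ρ β n δ).Subsingleton := by
  classical
  intro μ hμ ν hν
  haveI := hμ.1.1
  haveI := hν.1.1
  have hγ := isSpecification_ymSpecification_of_t2Space (d := d) ρ hρ β
  have hR : 0 ≤ R := (hr0 1 1).trans (hrR 1 1)
  exact DobrushinFrozen.measure_eq_of_dlrOn hγ hKR hr0 hrR hR hc0 hc1 hrow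
    (ℓ := fun e : ZdEdge d => ⌊‖e.1‖⌋₊) (fun x z hz => floor_norm_le_of_mem_linkPlaqNbr hz)
    (W := {e | IsSlabInteriorEdge n e}) (fun m => exists_finset_slabInterior_level n m) val hS hA0 hA δ
    hμ.2 hν.2 (dlr_ymSpecification_of_mem_slabGibbsMeasures ρ hμ)
    (dlr_ymSpecification_of_mem_slabGibbsMeasures ρ hν)

/-! ### §3 Uniqueness of the slab Gibbs measure gives unbroken centre symmetry -/

omit [T2Space G] in
/-- **A unique slab Gibbs measure is centre invariant**: the centre transforms act on
`slabGibbsMeasures ρ β n δ` for `n ≥ 1` (`map_centreTransform_mem_slabGibbsMeasures`: «`τ` is a symmetry of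
the specification `α`», Chatterjee 2021 §2.3; Georgii 2011 §5.1), so if that set has at most one element
every member is invariant — «uniqueness of the Gibbs measure trivially implies that center symmetry cannot
be spontaneously broken» (Chatterjee 2021, §12, first paragraph). [cite: Chatterjee2021, §2.3 and §12] -/
theorem slabCentreUnbroken_of_subsingleton (hρ : Continuous ρ) {β : ℝ} {n : ℕ} (hn : 1 ≤ n)
    {δ : LGConfig d G} (h : (slabGibbsMeasures ρ β n δ).Subsingleton) :
    SlabCentreUnbroken ρ β n δ :=
  fun _ hg₀ _ hμ => h (map_centreTransform_mem_slabGibbsMeasures ρ hρ hg₀ hn hμ) hμ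

/-- **Centre symmetry is unbroken at EVERY slab height in Dobrushin's regime** (every compact metrisable
`G`, every continuous `ρ`, every `d`, every boundary condition): Dobrushin's condition in the Vasserstein form
for the Wilson specification ⇒ `SlabCentreUnbroken ρ β n δ` for all `n ≥ 1` and `δ`.
[cite: Chatterjee2021, Def. 2.1 (with §2.4 p. 7, small β via Dobrushin–Shlosman)] -/
theorem slabCentreUnbroken_of_isKRContraction (hρ : Continuous ρ) {β : ℝ}
    {r : G → G → ℝ} {C : ZdEdge d → ZdEdge d → ℝ}
    (hKR : IsKRContraction (ymSpecification (d := d) ρ β) r linkPlaqNbr C)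
    {R : ℝ} (hr0 : ∀ a b, 0 ≤ r a b) (hrR : ∀ a b, r a b ≤ R)
    {X : Type*} [PseudoMetricSpace X] [MeasurableSpace X] [BorelSpace X] (val : G → X)
    (hS : ‹MeasurableSpace G› = MeasurableSpace.comap val ‹MeasurableSpace X›)
    {A : ℝ} (hA0 : 0 ≤ A) (hA : ∀ a b, dist (val a) (val b) ≤ A * r a b)
    {c : ℝ} (hc0 : 0 ≤ c) (hc1 : c < 1) (hrow : ∀ x, ∑ y ∈ linkPlaqNbr x, C x y ≤ c)
    {n : ℕ} (hn : 1 ≤ n) (δ : LGConfig d G) :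
    SlabCentreUnbroken ρ β n δ :=
  slabCentreUnbroken_of_subsingleton ρ hρ hn
    (subsingleton_slabGibbsMeasures_of_isKRContraction ρ hρ hKR hr0 hrR val hS hA0 hA hc0 hc1 hrow n δ)

/-- ★ **Chatterjee's criterion in Dobrushin's regime**: if the Wilson specification `ymSpecification ρ β`
satisfies Dobrushin's condition in the Vasserstein form, the lattice gauge theory has UNBROKEN CENTRE SYMMETRY
in the sense of Chatterjee 2021, Def. 2.1 (`CentreUnbroken d ρ β`, already at slab height `1`); with the
tree's proved Theorem 2.2 (`chatterjee2021_confinement_of_centreUnbroken_holds`) this is confinement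
(`V(R) → ∞`) for every irreducible representation seeing the centre. [cite: Chatterjee2021, Def. 2.1 and Thm. 2.2] -/
theorem centreUnbroken_of_isKRContraction (hρ : Continuous ρ) {β : ℝ}
    {r : G → G → ℝ} {C : ZdEdge d → ZdEdge d → ℝ}
    (hKR : IsKRContraction (ymSpecification (d := d) ρ β) r linkPlaqNbr C)
    {R : ℝ} (hr0 : ∀ a b, 0 ≤ r a b) (hrR : ∀ a b, r a b ≤ R)
    {X : Type*} [PseudoMetricSpace X] [MeasurableSpace X] [BorelSpace X] (val : G → X)
    (hS : ‹MeasurableSpace G› = MeasurableSpace.comap val ‹MeasurableSpace X›)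
    {A : ℝ} (hA0 : 0 ≤ A) (hA : ∀ a b, dist (val a) (val b) ≤ A * r a b)
    {c : ℝ} (hc0 : 0 ≤ c) (hc1 : c < 1) (hrow : ∀ x, ∑ y ∈ linkPlaqNbr x, C x y ≤ c) :
    CentreUnbroken d ρ β :=
  ⟨1, le_rfl, fun δ => slabCentreUnbroken_of_isKRContraction ρ hρ hKR hr0 hrR val hS hA0 hA hc0 hc1
    hrow le_rfl δ⟩

/-! ### §4 The total-variation corner `12 (d−1)² C_ρ |β| < 1`, every compact gauge group -/

omit [TopologicalSpace G] [IsTopologicalGroup G] [CompactSpace G] [MeasurableSpace G] [BorelSpace G]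
  [T2Space G] [SecondCountableTopology G] [NeZero d] in
/-- Oscillation of the one-link Wilson energy under a change of ONE other link: if `|Re tr ρ(U_p)| ≤ C`
uniformly, then for configurations agreeing off the link `y`, `|S_{x}(U) − S_{x}(U')| ≤ 2C · 2(d−1)`
(only the `≤ 2(d−1)` plaquettes through `y` contribute, each by `≤ 2C`; `abs_wilsonBoundaryAction_sub_le`,
`card_plaquettesTouching_singleton_le`). [folklore] -/
private theorem abs_wilsonBoundaryAction_singleton_sub_le {C : ℝ} (hC0 : 0 ≤ C)
    (hC : ∀ (z : Site d) (i j : Fin d) (U : LGConfig d G), |plaquetteObs ρ z i j U| ≤ C)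
    (x y : ZdEdge d) {U U' : LGConfig d G} (hU : ∀ e, e ≠ y → U e = U' e) :
    |wilsonBoundaryAction ρ {x} U - wilsonBoundaryAction ρ {x} U'| ≤
      2 * C * (2 * (d - 1 : ℕ) : ℕ) := by
  have h := abs_wilsonBoundaryAction_sub_le ρ hC0 hC {x} {y} (U := U) (U' := U')
    (fun e he => hU e (by simpa using he))
  refine h.trans ?_
  have hcard : ((plaquettesTouching ({y} : Finset (ZdEdge d))).card : ℝ) ≤
      ((2 * (d - 1 : ℕ) : ℕ) : ℝ) := by
    exact_mod_cast QuantumFieldTheory.card_plaquettesTouching_singleton_le y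
  exact mul_le_mul_of_nonneg_left hcard (by positivity)

omit [T2Space G] [NeZero d] in
/-- **Dobrushin's condition in the total-variation form for the Wilson specification of EVERY compact gauge
group** (re-proved in Literature after `Summits/Ventures/YMGap/Thresholds/StrongCouplingAllGroups.lean`,
`isKRContraction_ymSpecification_osc`): for `|Re tr ρ(U_p)| ≤ C` and every `β`, the one-link conditional laws
satisfy `IsKRContraction` for the discrete weight `r ≡ 1` over `linkPlaqNbr` with the uniform coefficient
`2(d−1) C |β|` — the two laws are Haar measure tilted by exponents `−β S_{x}` differing by `≤ 4(d−1) C |β|` in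
sup norm, and Simon's lemma (`abs_integral_tilted_sub_integral_tilted_le_linear'`) halves it.
[cite: Simon1979Dobrushin, Lemma and Remark 2] -/
theorem isKRContraction_ymSpecification_tv (hρ : Continuous ρ) {C : ℝ} (hC0 : 0 ≤ C)
    (hC : ∀ (z : Site d) (i j : Fin d) (U : LGConfig d G), |plaquetteObs ρ z i j U| ≤ C) (β : ℝ) :
    IsKRContraction (ymSpecification (d := d) ρ β) (fun _ _ => (1 : ℝ)) linkPlaqNbr
      (fun _ _ => ((2 * (d - 1 : ℕ) : ℕ) : ℝ) * C * |β|) := by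
  classical
  refine isKRContraction_ymSpecification ρ hρ β (fun _ _ => by positivity) ?_
  intro x y _ ω η hωη φ L hφm hφb hL hφL
  rw [siteLaw_ymSpecification_eq_tilted_haar ρ hρ β x ω,
    siteLaw_ymSpecification_eq_tilted_haar ρ hρ β x η]
  have hcont : ∀ ζ : LGConfig d G,
      Continuous fun g : G => -β * wilsonBoundaryAction ρ {x} (Function.update ζ x g) := fun ζ =>
    continuous_const.mul ((continuous_wilsonBoundaryAction ρ hρ {x}).comp
      (continuous_const.update x continuous_id))
  have hbdd : ∀ ζ : LGConfig d G,
      ∃ B, ∀ g : G, |-β * wilsonBoundaryAction ρ {x} (Function.update ζ x g)| ≤ B := fun ζ => by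
    refine ⟨|β| * (((N : ℝ) + C) * (plaquettesTouching ({x} : Finset (ZdEdge d))).card), fun g => ?_⟩
    rw [abs_mul, abs_neg]
    exact mul_le_mul_of_nonneg_left (abs_wilsonBoundaryAction_le ρ hC {x} _) (abs_nonneg β)
  have hε : ∀ g : G, |-β * wilsonBoundaryAction ρ {x} (Function.update ω x g) -
      -β * wilsonBoundaryAction ρ {x} (Function.update η x g)| ≤
        |β| * (2 * C * (2 * (d - 1 : ℕ) : ℕ)) := by
    intro g
    have hU : ∀ e, e ≠ y → Function.update ω x g e = Function.update η x g e := by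
      intro e he
      by_cases hex : e = x
      · subst hex; simp
      · rw [Function.update_of_ne hex, Function.update_of_ne hex, hωη e he]
    have h := abs_wilsonBoundaryAction_singleton_sub_le ρ hC0 hC x y hU
    rw [← mul_sub, abs_mul, abs_neg]
    exact mul_le_mul_of_nonneg_left h (abs_nonneg β)
  have key := abs_integral_tilted_sub_integral_tilted_le_linear' (haarProbability G)
    (hcont ω).measurable (hcont η).measurable (hbdd ω) (hbdd η) hε hφm hφb (L := L)
    (fun a b => by simpa using hφL a b)
  refine key.trans (le_of_eq ?_)
  push_cast
  ring

omit [Group G] [TopologicalSpace G] [IsTopologicalGroup G] [CompactSpace G] [MeasurableSpace G]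
  [BorelSpace G] [T2Space G] [SecondCountableTopology G] [NeZero d] in
/-- Row sums of the total-variation coefficient: a link has at most `6(d−1)` plaquette neighbours
(`card_linkPlaqNbr_le`), so `Σ_y 2(d−1) C |β| ≤ 12 (d−1)² C |β|`. [folklore] -/
private theorem tv_row_sum_le {C β : ℝ} (hC0 : 0 ≤ C) (x : ZdEdge d) :
    ∑ _y ∈ linkPlaqNbr x, ((2 * (d - 1 : ℕ) : ℕ) : ℝ) * C * |β| ≤
      12 * ((d - 1 : ℕ) : ℝ) ^ 2 * C * |β| := by
  rw [Finset.sum_const, nsmul_eq_mul]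
  have hcard : ((linkPlaqNbr x).card : ℝ) ≤ ((6 * (d - 1 : ℕ) : ℕ) : ℝ) := by
    exact_mod_cast card_linkPlaqNbr_le x
  calc ((linkPlaqNbr x).card : ℝ) * ((((2 * (d - 1 : ℕ) : ℕ)) : ℝ) * C * |β|)
      ≤ ((6 * (d - 1 : ℕ) : ℕ) : ℝ) * ((((2 * (d - 1 : ℕ) : ℕ)) : ℝ) * C * |β|) :=
        mul_le_mul_of_nonneg_right hcard (by positivity)
    _ = 12 * ((d - 1 : ℕ) : ℝ) ^ 2 * C * |β| := by push_cast; ring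

/-- ★ **At most one slab Gibbs measure in the total-variation corner, every compact gauge group**: for a
compact metrisable `G`, a continuous `ρ` with `|Re tr ρ(U_p)| ≤ C`, and `12 (d−1)² C |β| < 1`, the slab theory
of every height `n` with every boundary condition `δ` has at most one Gibbs measure. (Metric bookkeeping:
`val = id` and Urysohn's metric `TopologicalSpace.metrizableSpaceMetric`, bounded by compactness.)
[cite: Georgii2011, Thm. 8.20] -/
theorem subsingleton_slabGibbsMeasures_of_abs_plaquetteObs_le (hρ : Continuous ρ) {C : ℝ} (hC0 : 0 ≤ C)
    (hC : ∀ (z : Site d) (i j : Fin d) (U : LGConfig d G), |plaquetteObs ρ z i j U| ≤ C) {β : ℝ}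
    (hβ : 12 * ((d - 1 : ℕ) : ℝ) ^ 2 * C * |β| < 1) (n : ℕ) (δ : LGConfig d G) :
    (slabGibbsMeasures ρ β n δ).Subsingleton := by
  letI m : MetricSpace G := TopologicalSpace.metrizableSpaceMetric G
  obtain ⟨D, hD⟩ : ∃ D : ℝ, ∀ a b : G, dist a b ≤ D := by
    obtain ⟨D, hD⟩ := (isCompact_univ (X := G)).isBounded.subset_closedBall (1 : G)
    refine ⟨D + D, fun a b => ?_⟩
    have ha := hD (Set.mem_univ a)
    have hb := hD (Set.mem_univ b)
    rw [Metric.mem_closedBall] at ha hb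
    calc dist a b ≤ dist a 1 + dist 1 b := dist_triangle _ _ _
      _ ≤ D + D := by rw [dist_comm 1 b]; exact add_le_add ha hb
  have hD0 : 0 ≤ D := dist_nonneg.trans (hD 1 1)
  exact subsingleton_slabGibbsMeasures_of_isKRContraction ρ hρ (isKRContraction_ymSpecification_tv ρ hρ hC0 hC β)
    (fun _ _ => zero_le_one) (fun _ _ => le_rfl) id (by rw [MeasurableSpace.comap_id]) hD0
    (fun a b => by simpa using hD a b) (by positivity) hβ (fun x => tv_row_sum_le hC0 x) n δ

/-- ★ **Unbroken centre symmetry at every slab height in the corner `12 (d−1)² C_ρ |β| < 1`**, every compact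
gauge group, every boundary condition. [cite: Chatterjee2021, Def. 2.1 (with §2.4 p. 7, small β via Dobrushin–Shlosman)] -/
theorem slabCentreUnbroken_of_abs_plaquetteObs_le (hρ : Continuous ρ) {C : ℝ} (hC0 : 0 ≤ C)
    (hC : ∀ (z : Site d) (i j : Fin d) (U : LGConfig d G), |plaquetteObs ρ z i j U| ≤ C) {β : ℝ}
    (hβ : 12 * ((d - 1 : ℕ) : ℝ) ^ 2 * C * |β| < 1) {n : ℕ} (hn : 1 ≤ n) (δ : LGConfig d G) :
    SlabCentreUnbroken ρ β n δ :=
  slabCentreUnbroken_of_subsingleton ρ hρ hn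
    (subsingleton_slabGibbsMeasures_of_abs_plaquetteObs_le ρ hρ hC0 hC hβ n δ)

/-- ★ **Chatterjee's Definition 2.1 holds in the strong-coupling corner `12 (d−1)² C_ρ |β| < 1` for EVERY
compact gauge group** (`|Re tr ρ(U_p)| ≤ C_ρ`). With the tree's Theorem 2.2
(`chatterjee2021_confinement_of_centreUnbroken_holds`): confinement `|⟨W_{R×T}⟩| ≤ e^{−V(R)T}`, `V(R) → ∞`,
in every DLR state, for every irreducible representation acting non-trivially on the centre.
[cite: Chatterjee2021, Def. 2.1 and §2.4 (p. 7)] -/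
theorem centreUnbroken_of_abs_plaquetteObs_le (hρ : Continuous ρ) {C : ℝ} (hC0 : 0 ≤ C)
    (hC : ∀ (z : Site d) (i j : Fin d) (U : LGConfig d G), |plaquetteObs ρ z i j U| ≤ C) {β : ℝ}
    (hβ : 12 * ((d - 1 : ℕ) : ℝ) ^ 2 * C * |β| < 1) : CentreUnbroken d ρ β :=
  ⟨1, le_rfl, fun δ => slabCentreUnbroken_of_abs_plaquetteObs_le ρ hρ hC0 hC hβ le_rfl δ⟩

/-- **Unitary representations**: `|Re tr ρ(U_p)| ≤ N` (`abs_plaquetteObs_le_holds`), so centre symmetry is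
unbroken at every slab height whenever `12 (d−1)² N |β| < 1`. [cite: Chatterjee2021, Def. 2.1 and §2.4 (p. 7)] -/
theorem slabCentreUnbroken_of_unitary (hρ : Continuous ρ) (hρu : ∀ g, ρ g ∈ Matrix.unitaryGroup (Fin N) ℂ)
    {β : ℝ} (hβ : 12 * ((d - 1 : ℕ) : ℝ) ^ 2 * N * |β| < 1) {n : ℕ} (hn : 1 ≤ n) (δ : LGConfig d G) :
    SlabCentreUnbroken ρ β n δ :=
  slabCentreUnbroken_of_abs_plaquetteObs_le ρ hρ (Nat.cast_nonneg N) (abs_plaquetteObs_le_holds ρ hρu)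
    hβ hn δ

/-- **Unitary representations**: Chatterjee's Definition 2.1 holds whenever `12 (d−1)² N |β| < 1`
(`SU(2)`, `d = 4`, fundamental: `|β| < 1/216` in the tree's normalisation). [cite: Chatterjee2021, Def. 2.1 and §2.4 (p. 7)] -/
theorem centreUnbroken_of_unitary (hρ : Continuous ρ) (hρu : ∀ g, ρ g ∈ Matrix.unitaryGroup (Fin N) ℂ)
    {β : ℝ} (hβ : 12 * ((d - 1 : ℕ) : ℝ) ^ 2 * N * |β| < 1) : CentreUnbroken d ρ β :=
  centreUnbroken_of_abs_plaquetteObs_le ρ hρ (Nat.cast_nonneg N) (abs_plaquetteObs_le_holds ρ hρu) hβ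

/-- ★ **Every compact gauge group has a strong-coupling window of unbroken centre symmetry**
(hypothesis-free): for every compact metrisable `G`, every continuous `ρ` and every `d` there is `β₀ > 0`
such that Chatterjee's Definition 2.1 holds for all `|β| < β₀` (`|Re tr ρ|` is bounded on the compact
group, `exists_forall_abs_plaquetteObs_le`). [cite: Chatterjee2021, Def. 2.1 and §2.4 (p. 7)] -/
theorem exists_centreUnbroken_abs_lt (hρ : Continuous ρ) :
    ∃ β₀ : ℝ, 0 < β₀ ∧ ∀ β : ℝ, |β| < β₀ → CentreUnbroken d ρ β := by
  obtain ⟨C, hC0, hC⟩ := exists_forall_abs_plaquetteObs_le (d := d) ρ hρ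
  refine ⟨1 / (12 * ((d - 1 : ℕ) : ℝ) ^ 2 * C + 1), by positivity, fun β hβ => ?_⟩
  refine centreUnbroken_of_abs_plaquetteObs_le ρ hρ hC0 hC ?_
  have hK : 0 ≤ 12 * ((d - 1 : ℕ) : ℝ) ^ 2 * C := by positivity
  rw [lt_div_iff₀ (by positivity)] at hβ
  nlinarith [abs_nonneg β]

end Slab

end Literature.MathematicalPhysics.QuantumLattice

end
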